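import Summits.Ventures.WeilGRH.UniformConductorFloorLog11TableValidA
import Summits.Ventures.WeilGRH.UniformConductorFloorLog11TableValidB
import Summits.Ventures.WeilGRH.UniformConductorFloorLog11TableValidC
import Summits.Ventures.WeilGRH.UniformConductorFloorLog11TableValidD
import Summits.Ventures.WeilGRH.UniformConductorFloorLog11TableValidE
import Summits.Ventures.WeilGRH.UniformConductorFloorLog11TableValidF
import Summits.Ventures.WeilGRH.UniformConductorFloorLog11TableValidG
import Summits.Ventures.WeilGRH.UniformConductorFloorLog11TableValidH
import Summits.Ventures.WeilGRH.UniformConductorFloorLog11TableValidI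
import HarnessLib

/-!
# GRH arm (rh-explicit, venture WeilGRH): the special-value table `Log11Table` — `tab_valid : TabValid (2^80) a ks 144 tab` (glue of the kernel parts)

Cell `rh-explicit`, WEIL TRACK — GRH ARM (weil-grh-1 gen10; glue of the kernel parts A–I, re-cut from gen9's sequential chain so that the
parts after A import only A and file in parallel; slice width 17 at this window).  Part A certifies `P`, `A`, `C`, the prime data and the modes `0 … 19`;
the later parts certify `checkTable` slices; this file chains them with `TabValid.extend` into `tab_valid : TabValid (2^80) a ks 144 tab` — the input of
weil-grh-2's twisted cell kits (doors E/C) and of the table-based Galerkin refutation `UniformConductorFloorGalerkinTab` at this window.  No kernel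
computation here; no definitions; standard axioms. [cite: Moore1966, Ch. 3 (interval arithmetic: inclusion property)]
-/

namespace Summit.Ventures.WeilGRH.Log11Table
open Literature.NumberTheory.LFunctions Literature.NumberTheory.LFunctions.Yoshida1992 Encl Literature.Analysis.ValidatedNumerics.NumericsMP

/-- The table is valid below `37`. [cite: Moore1966, Ch. 3 (interval arithmetic: inclusion property)] -/
theorem tab_valid37 : TabValid (2 ^ 80) a ks (20 + 17) tab :=
  tab_valid20.extend fun n hn hnk ↦ idxValid_of_checkTable (prm := prm) (by norm_num [prm]) a_pos consts_valid tT20 hn hnk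

/-- The table is valid below `54`. [cite: Moore1966, Ch. 3 (interval arithmetic: inclusion property)] -/
theorem tab_valid54 : TabValid (2 ^ 80) a ks (37 + 17) tab :=
  tab_valid37.extend fun n hn hnk ↦ idxValid_of_checkTable (prm := prm) (by norm_num [prm]) a_pos consts_valid tT37 hn hnk

/-- The table is valid below `71`. [cite: Moore1966, Ch. 3 (interval arithmetic: inclusion property)] -/
theorem tab_valid71 : TabValid (2 ^ 80) a ks (54 + 17) tab :=
  tab_valid54.extend fun n hn hnk ↦ idxValid_of_checkTable (prm := prm) (by norm_num [prm]) a_pos consts_valid tT54 hn hnk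

/-- The table is valid below `88`. [cite: Moore1966, Ch. 3 (interval arithmetic: inclusion property)] -/
theorem tab_valid88 : TabValid (2 ^ 80) a ks (71 + 17) tab :=
  tab_valid71.extend fun n hn hnk ↦ idxValid_of_checkTable (prm := prm) (by norm_num [prm]) a_pos consts_valid tT71 hn hnk

/-- The table is valid below `105`. [cite: Moore1966, Ch. 3 (interval arithmetic: inclusion property)] -/
theorem tab_valid105 : TabValid (2 ^ 80) a ks (88 + 17) tab :=
  tab_valid88.extend fun n hn hnk ↦ idxValid_of_checkTable (prm := prm) (by norm_num [prm]) a_pos consts_valid tT88 hn hnk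

/-- The table is valid below `122`. [cite: Moore1966, Ch. 3 (interval arithmetic: inclusion property)] -/
theorem tab_valid122 : TabValid (2 ^ 80) a ks (105 + 17) tab :=
  tab_valid105.extend fun n hn hnk ↦ idxValid_of_checkTable (prm := prm) (by norm_num [prm]) a_pos consts_valid tT105 hn hnk

/-- The table is valid below `139`. [cite: Moore1966, Ch. 3 (interval arithmetic: inclusion property)] -/
theorem tab_valid139 : TabValid (2 ^ 80) a ks (122 + 17) tab :=
  tab_valid122.extend fun n hn hnk ↦ idxValid_of_checkTable (prm := prm) (by norm_num [prm]) a_pos consts_valid tT122 hn hnk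

/-- The table is valid below `144`. [cite: Moore1966, Ch. 3 (interval arithmetic: inclusion property)] -/
theorem tab_valid144 : TabValid (2 ^ 80) a ks (139 + 5) tab :=
  tab_valid139.extend fun n hn hnk ↦ idxValid_of_checkTable (prm := prm) (by norm_num [prm]) a_pos consts_valid tT139 hn hnk


end Summit.Ventures.WeilGRH.Log11Table
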